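import Literature.AlgebraicGeometry.Frobenioids.ArchimedeanBasicProperties
import Literature.AlgebraicGeometry.Frobenioids.ArchimedeanHullArrow
import Literature.AlgebraicGeometry.Frobenioids.ArchimedeanSlitRegion
import HarnessLib

/-!
# Frobenioids II, Theorem 3.6 (iv), second sentence: kernel-checked tests of the typed readings on `C₀`

Mochizuki, *The geometry of Frobenioids II*, Kyushu J. Math. **62** (2008) 401–460, §3, Thm. 3.6 (iv),
kurims p. 37 [cite: MochizukiFrdII2008, Thm 3.6 (iv) p.37]: "If, moreover, `Λ ∈ {ℤ, ℚ}`, then this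
factorization determines a faithful action of the image of `Aut_F(A)` in `Aut_{D₀}(A₀)` on `O^▷(A),
O^×(A)`." Flag register L1 #6 (referee ref-a A8-F3: FALSE as printed at `Λ = ℤ` for complex
non-isotropic `A`; probable intent = the isotropic-hull reading). On the model `C₀` of Ex. 3.3 (i)
(`ArchFrd.C0`, `C0.toElem`, seat abc-iut-L1-t6; the case `D = D₀`), with `Λ = ℤ`:

* at the SLIT object (angular part `S¹ ∖ {−1}`, `ArchFrd.slitRegion`, seat abc-iut-L1-t6) the arrow
  `(conj, 1, 1)` is an involutive automorphism over complex conjugation (`slitConjIso`); every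
  base-identity endomorphism of degree `1` has a positive REAL scalar, so conjugation by it fixes `O^▷`
  and `O^×` pointwise; hence the printed-as-typed predicate `Thm36iv_faithful G C0.toElem ℤ`
  (`ArchimedeanBasicProperties.lean`) is FALSE for every comparison functor `G : D₀ → ArchBase` with
  `G.map conj ≠ 𝟙` — `not_thm36iv_faithful_C0_slit` (UNCONDITIONAL);
* the repaired reading restricted to isotropic objects (`Thm36iv_faithful_of_isIsotropic`, layer ruling
  2026-08-25T19:26:58Z (c)) HOLDS on `C₀` for every `G` — `thm36iv_faithful_of_isIsotropic_C0'`
  (UNCONDITIONAL; real objects have trivial `Aut_{D₀}`, and on a complex isotropic object the unit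
  `i ∈ O^×(A) ≅ S¹` separates the identity from complex conjugation; "isotropic ⇒ naively isotropic" is
  `ArchimedeanHullArrow.lean`).

HONEST FRAMING: this tests OUR typed readings of one sentence of a 2008 paper on OUR model; it asserts
nothing about [IUTchI–IV]; the typed statement is kept, labelled, in `ArchimedeanBasicProperties.lean`.
-/

namespace Literature.AlgebraicGeometry.Frobenioids

open CategoryTheory
open scoped Pointwise

namespace ArchFrd

namespace C0

/-- The unit part is multiplicative ([FrdII] Def. 3.1 (ii), the decomposition is a group isomorphism).
[cite: MochizukiFrdII2008, Def 3.1 (ii) p.24] -/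
private theorem unitPart_mul (a b : ℂˣ) : unitPart ℂ (a * b) = unitPart ℂ a * unitPart ℂ b :=
  congrArg Prod.fst (map_mul (unitDecomposition ℂ).symm a b)

/-- The unit part commutes with complex conjugation on `ℂ^×`. [cite: MochizukiFrdII2008, Def 3.1 (ii) p.23] -/
theorem unitPart_star (u : ℂˣ) : (unitPart ℂ (star u) : ℂˣ) = star (unitPart ℂ u : ℂˣ) := by
  set z := unitPart ℂ u
  set r := absHom ℂ u
  have hu : (z : ℂˣ) * ofPosReal ℂ r = u := (unitDecomposition ℂ).apply_symm_apply u
  have hz : star (z : ℂˣ) ∈ normOneSubgroup ℂ := by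
    rw [mem_normOneSubgroup_iff, Units.coe_star, Complex.star_def, Complex.norm_conj]
    exact z.2
  have hreal : star (ofPosReal ℂ r) = ofPosReal ℂ r :=
    Units.ext (by rw [Units.coe_star, coe_ofPosReal]; exact Complex.conj_ofReal _)
  have key := (unitPart_mul_ofPosReal_eq ⟨star (z : ℂˣ), hz⟩ r).1
  rw [← hu, star_mul, hreal, mul_comm, key]

section Slit

variable (R : AngularRegion ℂ)

/-- The complex object of `C₀` with angular region `R` (a slit object when `R.dir = S¹ ∖ {−1}`, "the
complement in `S¹` of a single element", Ex. 3.3 (v) p. 29). [cite: MochizukiFrdII2008, Ex 3.3 (v) p.29] -/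
abbrev slitObj : C0 := ⟨.complex, R, fun h => D0.noConfusion h⟩

variable (hR : R.dir = {z | z ≠ negOneUnit})
include hR

/-- A slit region is stable under complex conjugation (its direction set `S¹ ∖ {−1}` is).
[cite: MochizukiFrdII2008, Ex 3.3 (v) p.29] -/
theorem star_mem_carrier {u : ℂˣ} (hu : u ∈ R.carrier) : star u ∈ R.carrier := by
  obtain ⟨hdir, habs⟩ := hu
  refine ⟨?_, ?_⟩
  · rw [hR] at hdir ⊢
    simp only [Set.mem_setOf_eq] at hdir ⊢
    intro h
    have h' : star (unitPart ℂ u : ℂˣ) = (negOneUnit : ℂˣ) := by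
      rw [← unitPart_star]; exact congrArg Subtype.val h
    apply hdir
    apply Subtype.ext
    rw [← star_star (unitPart ℂ u : ℂˣ), h']
    exact Units.ext (by rw [Units.coe_star]; change star ((-1 : ℂˣ) : ℂ) = ((-1 : ℂˣ) : ℂ); simp)
  · have : absHom ℂ (star u) = absHom ℂ u := by rw [← D0.galAct_true]; exact absHom_galAct true u
    rw [this]; exact habs

/-- `conj(A) = A` for a slit region. [cite: MochizukiFrdII2008, Ex 3.3 (v) p.29] -/
theorem image_star_carrier : D0.galAct true '' R.carrier = R.carrier := by
  ext x
  constructor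
  · rintro ⟨y, hy, rfl⟩
    rw [D0.galAct_true]; exact star_mem_carrier R hR hy
  · intro hx
    exact ⟨star x, star_mem_carrier R hR hx, by rw [D0.galAct_true, star_star]⟩

/-- The arrow `(conj, deg_Fr = 1, scalar = 1)` of the slit object: an endomorphism of `C₀` lying over
complex conjugation. [cite: MochizukiFrdII2008, Ex 3.3 (i) p.27] -/
noncomputable def slitConj : slitObj R ⟶ slitObj R where
  base := D0.conj
  degFr := 1
  scalar := 1
  scalar_mem := one_mem _
  mapsTo := by
    rw [one_smul, PNat.one_coe, pow_one]
    change R.carrier ⊆ D0.galAct (D0.Hom.twists D0.conj) '' R.carrier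
    rw [D0.twists_conj, image_star_carrier R hR]

/-- `slitConj` is an involution. [cite: MochizukiFrdII2008, Ex 3.3 (i) p.27] -/
theorem slitConj_comp_slitConj : slitConj R hR ≫ slitConj R hR = 𝟙 (slitObj R) := by
  refine hom_ext ?_ rfl ?_
  · exact D0.conj_comp_conj
  · rw [scalar_comp', scalar_id']
    change D0.galAct (D0.Hom.twists D0.conj) 1 * 1 ^ ((1 : ℕ+) : ℕ) = 1
    rw [map_one, one_pow, one_mul]

/-- `slitConj` as an automorphism of the slit object. [cite: MochizukiFrdII2008, Ex 3.3 (i) p.27] -/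
noncomputable def slitConjIso : slitObj R ≅ slitObj R :=
  ⟨slitConj R hR, slitConj R hR, slitConj_comp_slitConj R hR, slitConj_comp_slitConj R hR⟩

/-- A base-identity endomorphism of degree `1` of the slit object has scalar `c` with `c · A ⊆ A`; a
rotation cannot map `S¹ ∖ {−1}` into itself, so `c ∈ ℝ_{>0}`. [cite: MochizukiFrdII2008, Thm 3.6 (iv) p.37] -/
theorem unitPart_scalar_eq_one_of_endo (f : slitObj R ⟶ slitObj R)
    (hb : Hom.base f = 𝟙 (slitObj R).base) (hd : Hom.degFr f = 1) :
    unitPart ℂ (Hom.scalar f) = 1 := by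
  by_contra hw
  set c : ℂˣ := Hom.scalar f with hc
  set w : normOneSubgroup ℂ := unitPart ℂ c with hw'
  -- the scaled region is contained in the region
  have hsub : c • R.carrier ⊆ R.carrier := by
    have h := Hom.mapsTo f
    rw [hd, PNat.one_coe, pow_one, hb, pullRegion_id] at h
    exact h
  -- a test vector in direction `w⁻¹ · (−1)` on the boundary circle
  let u₀ : ℂˣ := ((w⁻¹ * negOneUnit : normOneSubgroup ℂ) : ℂˣ) * ofPosReal ℂ R.tip
  obtain ⟨hu₀dir, hu₀abs⟩ := unitPart_mul_ofPosReal_eq (w⁻¹ * negOneUnit) R.tip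
  have hu₀ : u₀ ∈ R.carrier := by
    refine ⟨?_, ?_⟩
    · rw [hu₀dir, hR]
      simp only [Set.mem_setOf_eq]
      intro h
      apply hw
      have h1 : w⁻¹ * negOneUnit = 1 * negOneUnit := by rw [one_mul]; exact h
      exact inv_eq_one.mp (mul_right_cancel h1)
    · rw [hu₀abs]
  have hcu₀ : c * u₀ ∈ R.carrier := hsub (Set.smul_mem_smul_set hu₀)
  -- but its direction is exactly `−1`
  have hdir : unitPart ℂ (c * u₀) = negOneUnit := by
    rw [unitPart_mul, hu₀dir, ← hw', ← mul_assoc, mul_inv_cancel, one_mul]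
  have hmem := hcu₀.1
  rw [hdir, hR] at hmem
  simp only [Set.mem_setOf_eq] at hmem
  exact hmem rfl

/-- Hence the scalar of such an endomorphism is real: fixed by complex conjugation.
[cite: MochizukiFrdII2008, Thm 3.6 (iv) p.37] -/
theorem star_scalar_eq_of_endo (f : slitObj R ⟶ slitObj R)
    (hb : Hom.base f = 𝟙 (slitObj R).base) (hd : Hom.degFr f = 1) :
    star (Hom.scalar f) = Hom.scalar f := by
  have h1 := unitPart_scalar_eq_one_of_endo R hR f hb hd
  have hdec : (unitPart ℂ (Hom.scalar f) : ℂˣ) * ofPosReal ℂ (absHom ℂ (Hom.scalar f)) = Hom.scalar f :=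
    (unitDecomposition ℂ).apply_symm_apply (Hom.scalar f)
  rw [h1] at hdec
  rw [← hdec]
  change star ((1 : ℂˣ) * ofPosReal ℂ (absHom ℂ (Hom.scalar f))) =
    (1 : ℂˣ) * ofPosReal ℂ (absHom ℂ (Hom.scalar f))
  rw [one_mul]
  exact Units.ext (by rw [Units.coe_star, coe_ofPosReal]; exact Complex.conj_ofReal _)

/-- Conjugating a base-identity endomorphism of Frobenius degree `1` of the slit object by `slitConj`
does nothing. [cite: MochizukiFrdII2008, Thm 3.6 (iv) p.37] -/
theorem slitConj_conj_eq (f : slitObj R ⟶ slitObj R)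
    (hb : Hom.base f = 𝟙 (slitObj R).base) (hd : Hom.degFr f = 1) :
    slitConj R hR ≫ f ≫ slitConj R hR = f := by
  refine hom_ext ?_ ?_ ?_
  · rw [base_comp', base_comp']
    change D0.conj ≫ Hom.base f ≫ D0.conj = Hom.base f
    rw [hb, Category.id_comp]
    exact D0.conj_comp_conj
  · rw [degFr_comp', degFr_comp']
    change 1 * (Hom.degFr f * 1) = Hom.degFr f
    rw [one_mul, mul_one]
  · rw [scalar_comp', scalar_comp']
    change D0.galAct (D0.Hom.twists D0.conj)
        (D0.galAct (D0.Hom.twists (Hom.base f)) 1 * Hom.scalar f ^ ((1 : ℕ+) : ℕ)) *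
        1 ^ (degFr (f ≫ slitConj R hR) : ℕ) = Hom.scalar f
    rw [one_pow, mul_one, map_one, one_mul, PNat.one_coe, pow_one, D0.twists_conj, D0.galAct_true]
    exact star_scalar_eq_of_endo R hR f hb hd

/-- The conjugation action of `slitConjIso` on `O^▷(A)` (base-identity linear endomorphisms, [FrdI]
Def. 1.2 (ii), for the structure functor `C0.toElem`) is trivial. [cite: MochizukiFrdII2008, Thm 3.6 (iv) p.37] -/
theorem conj_action_trivial_end (f : End (slitObj R))
    (hf : f ∈ PreFrobenioid.endSubmonoid C0.toElem (slitObj R)) :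
    (slitConjIso R hR).inv ≫ f ≫ (slitConjIso R hR).hom = f :=
  slitConj_conj_eq R hR f hf.1 hf.2

/-- The conjugation action of `slitConjIso` on `O^×(A)` is trivial. [cite: MochizukiFrdII2008, Thm 3.6 (iv) p.37] -/
theorem conj_action_trivial_units (u : Aut (slitObj R))
    (hu : u ∈ PreFrobenioid.unitsSubgroup C0.toElem (slitObj R)) :
    (slitConjIso R hR).symm ≪≫ u ≪≫ slitConjIso R hR = u :=
  Iso.ext (by
    rw [Iso.trans_hom, Iso.trans_hom, Iso.symm_hom]
    exact slitConj_conj_eq R hR u.hom hu.1 hu.2)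

/-- **The typed reading of Thm. 3.6 (iv), sentence 2, fails on `C₀` (`Λ = ℤ`)** for any angular region
with angular part `S¹ ∖ {−1}` and any `G` not killing complex conjugation: at the slit object,
`slitConjIso` and the identity act identically on `O^▷`, `O^×` but differ in `Aut_{D₀}(A₀)`.
[cite: MochizukiFrdII2008, Thm 3.6 (iv) p.37] -/
theorem not_thm36iv_faithful_C0 (G : D0 ⥤ ArchBase) (hG : G.map D0.conj ≠ 𝟙 (G.obj .complex)) :
    ¬ Thm36iv_faithful G C0.toElem MonoidType.Z := by
  intro h
  have key := h (by decide) (slitObj R) (slitConjIso R hR) (Iso.refl _)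
    (fun f hf => by rw [conj_action_trivial_end R hR f hf]; simp)
    (fun u hu => by rw [conj_action_trivial_units R hR u hu]; simp)
  have hhom := congrArg Iso.hom key
  rw [Functor.mapIso_hom, Functor.mapIso_hom, Iso.refl_hom, CategoryTheory.Functor.map_id] at hhom
  exact hG hhom

end Slit

/-- **UNCONDITIONAL form** on `C₀` with the slit region of `ArchimedeanSlitRegion.lean` (seat
abc-iut-L1-t6): for every comparison functor `G : D₀ → ArchBase` not killing complex conjugation (e.g.
`ArchFrd.D0.toArchBase`), the printed-as-typed reading `Thm36iv_faithful G C0.toElem ℤ` is false.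
[cite: MochizukiFrdII2008, Thm 3.6 (iv) p.37] -/
theorem not_thm36iv_faithful_C0_slit (t : PosReal) (G : D0 ⥤ ArchBase)
    (hG : G.map D0.conj ≠ 𝟙 (G.obj .complex)) : ¬ Thm36iv_faithful G C0.toElem MonoidType.Z :=
  not_thm36iv_faithful_C0 (slitRegion t) (slitRegion_dir t) G hG

/-! ### The repaired reading (3) holds on `C₀`: isotropic objects -/

section Isotropic

/-- The Frobenius degree of an isomorphism of `C₀` is `1` (degrees are multiplicative and positive).
[cite: MochizukiFrdII2008, Ex 3.3 (i) p.27] -/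
theorem degFr_eq_one_of_iso {A B : C0} (α : A ≅ B) : degFr α.hom = 1 := by
  have h : degFr (α.hom ≫ α.inv) = degFr (𝟙 A) := by rw [α.hom_inv_id]
  rw [degFr_comp', degFr_id'] at h
  have h' : (degFr α.hom : ℕ) * (degFr α.inv : ℕ) = 1 := by
    rw [← PNat.mul_coe, h]; rfl
  exact PNat.coe_eq_one_iff.mp (Nat.eq_one_of_mul_eq_one_right h')

/-- The scalar of an isomorphism of `C₀` and of its inverse: `Base(α⁻¹)·(scalar α) · scalar α⁻¹ = 1`.
[cite: MochizukiFrdII2008, Ex 3.3 (i) p.27] -/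
theorem act_scalar_mul_scalar_inv {A : C0} (α : A ≅ A) :
    (Base α.inv).act (scalar α.hom) * scalar α.inv = 1 := by
  have h : scalar (α.inv ≫ α.hom) = scalar (𝟙 A) := by rw [α.inv_hom_id]
  rw [scalar_comp', scalar_id', degFr_eq_one_of_iso α, PNat.one_coe, pow_one] at h
  exact h

/-- Conjugating a base-identity endomorphism of Frobenius degree `1` (scalar `c`) by an automorphism
`α` of `C₀` yields the endomorphism with scalar `Base(α⁻¹)·c` (the field embedding applied to `c`).
[cite: MochizukiFrdII2008, Thm 3.6 (iv) p.37] -/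
theorem scalar_conj {A : C0} (α : A ≅ A) (u : A ⟶ A) (hb : Base u = 𝟙 A.base)
    (hd : degFr u = 1) :
    scalar (α.inv ≫ u ≫ α.hom) = (Base α.inv).act (scalar u) := by
  have h2 := act_scalar_mul_scalar_inv α
  change D0.galAct (D0.Hom.twists (Base α.inv)) (scalar α.hom) * scalar α.inv = 1 at h2
  rw [scalar_comp', scalar_comp', degFr_comp', hb, hd, degFr_eq_one_of_iso α, one_mul]
  change D0.galAct (D0.Hom.twists (Base α.inv))
      (D0.galAct (D0.Hom.twists (𝟙 A.base)) (scalar α.hom) * scalar u ^ ((1 : ℕ+) : ℕ)) *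
      scalar α.inv ^ ((1 : ℕ+) : ℕ) = D0.galAct (D0.Hom.twists (Base α.inv)) (scalar u)
  rw [D0.twists_id, D0.galAct_false, PNat.one_coe, pow_one, pow_one, map_mul, mul_right_comm, h2,
    one_mul]

/-- For a complex naively isotropic object, multiplication by a scalar of norm `1` (base the identity,
degree `1`) is an endomorphism: `c · A_K = A_K` for an isotropic angular region.
[cite: MochizukiFrdII2008, Ex 3.3 (i) p.27] -/
noncomputable def unitScalarEnd (A : C0) (hA : A.IsNaivelyIsotropic) (hc : A.IsComplexObj) (c : ℂˣ)
    (hn : ‖(c : ℂ)‖ = 1) : A ⟶ A where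
  base := 𝟙 A.base
  degFr := 1
  scalar := c
  scalar_mem := by
    have : A.base = .complex := hc
    rw [this, D0.scalars_complex]; exact Subgroup.mem_top c
  mapsTo := by
    rw [PNat.one_coe, pow_one, pullRegion_id]
    rintro _ ⟨u, hu, rfl⟩
    have habs : absHom ℂ c = 1 := Subtype.ext (by rw [coe_absHom, hn]; rfl)
    rw [mem_carrier_of_isIsotropic hA] at hu ⊢
    change absHom ℂ (c * u) ≤ A.region.tip
    rwa [map_mul, habs, one_mul]

/-- The scalar of `unitScalarEnd`. [cite: MochizukiFrdII2008, Ex 3.3 (i) p.27] -/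
@[simp] theorem scalar_unitScalarEnd (A : C0) (hA : A.IsNaivelyIsotropic) (hc : A.IsComplexObj)
    (c : ℂˣ) (hn : ‖(c : ℂ)‖ = 1) : scalar (unitScalarEnd A hA hc c hn) = c := rfl

/-- `unitScalarEnd c` and `unitScalarEnd c⁻¹` are mutually inverse. [cite: MochizukiFrdII2008, Ex 3.3 (i) p.27] -/
theorem unitScalarEnd_comp (A : C0) (hA : A.IsNaivelyIsotropic) (hc : A.IsComplexObj) (c : ℂˣ)
    (hn : ‖(c : ℂ)‖ = 1) (hn' : ‖((c⁻¹ : ℂˣ) : ℂ)‖ = 1) :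
    unitScalarEnd A hA hc c hn ≫ unitScalarEnd A hA hc c⁻¹ hn' = 𝟙 A := by
  refine hom_ext (Category.id_comp _) rfl ?_
  rw [scalar_comp', scalar_id']
  change D0.galAct (D0.Hom.twists (𝟙 A.base)) c⁻¹ * c ^ ((1 : ℕ+) : ℕ) = 1
  rw [D0.twists_id, D0.galAct_false, PNat.one_coe, pow_one, inv_mul_cancel]

/-- The unit `c ∈ O^×(A) ≅ S¹` of a complex naively isotropic object, as an automorphism of `C₀`.
[cite: MochizukiFrdII2008, Thm 3.6 (v) p.37] -/
noncomputable def unitScalarAut (A : C0) (hA : A.IsNaivelyIsotropic) (hc : A.IsComplexObj) (c : ℂˣ)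
    (hn : ‖(c : ℂ)‖ = 1) : A ≅ A where
  hom := unitScalarEnd A hA hc c hn
  inv := unitScalarEnd A hA hc c⁻¹ (by rw [Units.val_inv_eq_inv_val, norm_inv, hn, inv_one])
  hom_inv_id := unitScalarEnd_comp A hA hc c hn _
  inv_hom_id := by
    have h := unitScalarEnd_comp A hA hc c⁻¹
      (by rw [Units.val_inv_eq_inv_val, norm_inv, hn, inv_one]) (by rw [inv_inv]; exact hn)
    simpa only [inv_inv] using h

/-- `unitScalarAut c ∈ O^×(A)` (base-identity and linear for the structure functor `C0.toElem`).
[cite: MochizukiFrdII2008, Thm 3.6 (v) p.37] -/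
theorem unitScalarAut_mem (A : C0) (hA : A.IsNaivelyIsotropic) (hc : A.IsComplexObj) (c : ℂˣ)
    (hn : ‖(c : ℂ)‖ = 1) :
    unitScalarAut A hA hc c hn ∈ PreFrobenioid.unitsSubgroup C0.toElem A := by
  change PreFrobenioid.IsBaseIdentity C0.toElem (unitScalarAut A hA hc c hn).hom ∧
    PreFrobenioid.IsLinear C0.toElem (unitScalarAut A hA hc c hn).hom
  exact ⟨rfl, rfl⟩

/-- An endomorphism of `Spec ℂ` in `D₀` is determined by its twist. [cite: MochizukiFrdII2008, §3 p.23] -/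
private theorem D0_hom_complex_eq_of_twists_eq (f g : D0.complex ⟶ D0.complex)
    (h : D0.Hom.twists f = D0.Hom.twists g) : f = g := by
  rcases D0.hom_complex_complex_eq f with rfl | rfl <;>
    rcases D0.hom_complex_complex_eq g with rfl | rfl
  · rfl
  · rw [D0.twists_id, D0.twists_conj] at h; exact absurd h (by decide)
  · rw [D0.twists_id, D0.twists_conj] at h; exact absurd h (by decide)
  · rfl

/-- **Reading (3) of Theorem 3.6 (iv), second sentence, HOLDS on `C₀`** (`Λ = ℤ`, any comparison
functor `G`), granted Example 3.3 (ii)'s "isotropic ⟺ naively isotropic" (seat abc-iut-L1-t6, named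
statement `Ex33ii_isIsotropic_iff_naive`; taken here as the hypothesis `hiso`): for an isotropic
object, automorphisms acting identically on `O^×(A)` have the same image in `Aut_{D₀}(A₀)` — for real
`A` because `Aut_{D₀}(Spec ℝ)` is trivial, for complex `A` because the unit `i ∈ O^×(A) ≅ S¹` is moved
by complex conjugation. [cite: MochizukiFrdII2008, Thm 3.6 (iv) p.37] -/
theorem thm36iv_faithful_of_isIsotropic_C0 (G : D0 ⥤ ArchBase)
    (hiso : ∀ A : C0, PreFrobenioid.IsIsotropic C0.toElem A → A.IsNaivelyIsotropic) :
    Thm36iv_faithful_of_isIsotropic G C0.toElem MonoidType.Z := by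
  intro _ A hA α α' _ hunits
  -- it suffices to compare the base components of the inverses
  suffices hinv : Base α.inv = Base α'.inv by
    have hsymm : (PreFrobenioid.baseFunctor C0.toElem ⋙ G).mapIso α.symm =
        (PreFrobenioid.baseFunctor C0.toElem ⋙ G).mapIso α'.symm :=
      Iso.ext (by
        change G.map (Base α.inv) = G.map (Base α'.inv)
        rw [hinv])
    have := congrArg Iso.symm hsymm
    simpa only [Functor.mapIso_symm, Iso.symm_symm_eq] using this
  obtain ⟨K, R, hK⟩ := A
  cases K with
  | real => exact Subsingleton.elim _ _
  | complex =>
    have hnaive : (⟨.complex, R, hK⟩ : C0).IsNaivelyIsotropic := hiso _ hA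
    have hcx : (⟨.complex, R, hK⟩ : C0).IsComplexObj := rfl
    have hI : ‖((Units.mk0 Complex.I Complex.I_ne_zero : ℂˣ) : ℂ)‖ = 1 := by simp
    let u := unitScalarAut ⟨.complex, R, hK⟩ hnaive hcx (Units.mk0 Complex.I Complex.I_ne_zero) hI
    have hu := hunits u (unitScalarAut_mem _ hnaive hcx _ hI)
    have hsc := congrArg (fun i : (⟨.complex, R, hK⟩ : C0) ≅ ⟨.complex, R, hK⟩ => scalar i.hom) hu
    simp only [Iso.trans_hom, Iso.symm_hom] at hsc
    change scalar (α.inv ≫ u.hom ≫ α.hom) = scalar (α'.inv ≫ u.hom ≫ α'.hom) at hsc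
    rw [scalar_conj α u.hom rfl rfl, scalar_conj α' u.hom rfl rfl] at hsc
    change D0.galAct (D0.Hom.twists (Base α.inv)) (Units.mk0 Complex.I Complex.I_ne_zero) =
      D0.galAct (D0.Hom.twists (Base α'.inv)) (Units.mk0 Complex.I Complex.I_ne_zero) at hsc
    apply D0_hom_complex_eq_of_twists_eq
    -- the twists agree, since `conj(i) = -i ≠ i`
    by_contra hne
    have key : ∀ σ τ : Bool, σ ≠ τ →
        D0.galAct σ (Units.mk0 Complex.I Complex.I_ne_zero) ≠
          D0.galAct τ (Units.mk0 Complex.I Complex.I_ne_zero) := by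
      intro σ τ hστ h
      have hI' : ((D0.galAct true (Units.mk0 Complex.I Complex.I_ne_zero) : ℂˣ) : ℂ) =
          ((D0.galAct false (Units.mk0 Complex.I Complex.I_ne_zero) : ℂˣ) : ℂ) := by
        cases σ <;> cases τ
        · exact absurd rfl hστ
        · exact (congrArg (fun x : ℂˣ => (x : ℂ)) h).symm
        · exact congrArg (fun x : ℂˣ => (x : ℂ)) h
        · exact absurd rfl hστ
      rw [D0.galAct_true, D0.galAct_false, Units.coe_star, Units.val_mk0, Complex.star_def,
        Complex.conj_I] at hI'
      exact Complex.I_ne_zero (by linear_combination (-1 : ℂ) / 2 * hI')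
    exact key _ _ hne hsc

/-- **Reading (3) holds on `C₀`, UNCONDITIONALLY** (the isotropy hypothesis is discharged by
`isNaivelyIsotropic_of_frobIsotropic`). [cite: MochizukiFrdII2008, Thm 3.6 (iv) p.37] -/
theorem thm36iv_faithful_of_isIsotropic_C0' (G : D0 ⥤ ArchBase) :
    Thm36iv_faithful_of_isIsotropic G C0.toElem MonoidType.Z :=
  thm36iv_faithful_of_isIsotropic_C0 G isNaivelyIsotropic_of_frobIsotropic

end Isotropic

end C0

end ArchFrd

end Literature.AlgebraicGeometry.Frobenioids
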